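import Mathlib.Analysis.SpecialFunctions.Log.Basic
import HarnessLib

/-!
# K2R `RealisedQuasiStaticCellLaw`, line `floquet-bloch`: choosing the capped contraction factor `θ = e^{-c}` (real-arithmetic
# template for the rate comparison; helper towards `stub_lowSectorDecay`; `--supports stmt-AnomalousDissipation-20446`)

Summits-side helper file (everything proved; no definitions, no named facts). `sectorDecay_ae_cap` holds for any
`θ ∈ [θ₀, 1]`, `θ₀ = min 1 (max (A e^{-a}) (e^{-b}))` (`A = 2·(5/3)`, `a = r_P w`, `b = r_F w`). Choosing `θ = e^{-c}` with the
TARGET exponent `c = (required rate)·P` is admissible as soon as `0 ≤ c ≤ b` and `log A + c ≤ a` (`cap_choice`), and then the decay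
reads `e^{c} · exp(-(c/P) t)` (`log_inv_exp_neg`, `inv_exp_neg`): recipe v2 §(ii) reduces to the two scalar inequalities
`c ≤ r_F w` and `log(10/3) + c ≤ r_P w`.
-/

set_option linter.dupNamespace false

noncomputable section

namespace Summit.AnomalousDissipation.AnomalousDissipation.Theorems.SolenoidalFractalHomogenisation.RealisedQuasiStaticCellLaw

/-- **Admissible capped factor.** If `1 ≤ A`, `0 ≤ c ≤ b` and `log A + c ≤ a` then
`min 1 (max (A e^{-a}) (e^{-b})) ≤ e^{-c} ≤ 1`. -/
theorem cap_choice {A a b c : ℝ} (hA : 1 ≤ A) (hc0 : 0 ≤ c) (hcb : c ≤ b) (hca : Real.log A + c ≤ a) :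
    min 1 (max (A * Real.exp (-a)) (Real.exp (-b))) ≤ Real.exp (-c) ∧ Real.exp (-c) ≤ 1 := by
  have hApos : 0 < A := by linarith
  refine ⟨(min_le_right _ _).trans (max_le ?_ ?_), ?_⟩
  · -- `A e^{-a} = e^{log A - a} ≤ e^{-c}`
    rw [← Real.exp_log hApos, ← Real.exp_add, Real.exp_le_exp]
    linarith
  · exact Real.exp_le_exp.2 (by linarith)
  · rw [← Real.exp_zero]; exact Real.exp_le_exp.2 (by linarith)

/-- `log ((e^{-c})⁻¹) = c`. -/
theorem log_inv_exp_neg (c : ℝ) : Real.log (Real.exp (-c))⁻¹ = c := by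
  rw [← Real.exp_neg, neg_neg, Real.log_exp]

/-- `(e^{-c})⁻¹ = e^{c}`. -/
theorem inv_exp_neg (c : ℝ) : (Real.exp (-c))⁻¹ = Real.exp c := by
  rw [← Real.exp_neg, neg_neg]

/-- **The capped decay in target form**: with `θ = e^{-c}`, `θ⁻¹ e^{-(log θ⁻¹/P) t} = e^{c} e^{-(c/P) t}`. -/
theorem cap_decay_form (c P t : ℝ) :
    (Real.exp (-c))⁻¹ * Real.exp (-(Real.log (Real.exp (-c))⁻¹ / P) * t) = Real.exp c * Real.exp (-(c / P) * t) := by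
  rw [log_inv_exp_neg, inv_exp_neg]

end Summit.AnomalousDissipation.AnomalousDissipation.Theorems.SolenoidalFractalHomogenisation.RealisedQuasiStaticCellLaw

end
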